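import Summits.QuantumFields.GaugeBoot.ClassBLimitLinkCutWordBlocks
import Summits.QuantumFields.GaugeBoot.TiltedBoxLimitCovariantLinkRP
import Summits.QuantumFields.GaugeBoot.TiltedBoxLimitHaarShift
import Summits.QuantumFields.GaugeBoot.HaarShiftPlaquetteSign
import Summits.QuantumFields.GaugeBoot.DLRPlaquetteSign
import HarnessLib

/-!
# Covariant link RP is inconsistent with the one-link Haar shift at negative coupling
(gauge-boot, Class-B / Class-T brick; the covariant link family at `β < 0`)

HONEST FRAMING (cell `pub-gaugeboot`, page 1 of every file): the venture produces certified bounds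
on lattice expectations at stated coupling, gauge group, dimension and torus size; NOT a mass gap,
NOT a continuum limit, NOT a string tension; NOT Yang–Mills-summit-bearing (barriers
`FixedCouplingUltralocality`, `PerturbativeInvisibility`). Structural bookkeeping (which SDP blocks
are exact for which infinite-volume states); certifies no number.

## Content

`ZdCovariantLinkRP.lean` typed the covariant (Osterwalder–Seiler, half-link) form of link
reflection positivity on `ℤ^d`, `IsCovariantLinkRP i μ`, the form that justifies Kazakov–Zheng's
link-type CUT-LOOP `R_link` word blocks (`ClassBLinkCutWordBlocks.lean`); it was proved for every
torus limit point (`β ≥ 0`, every axis) and every tilted (Class-T) limit point (`β ≥ 0`, axes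
`k ∉ {i, j}`). `HaarShiftPlaquetteSign.lean` proved the DLR sign rule: in every probability
one-link Haar-shift state at `β < 0` (`ρ` without invariant vectors) the plaquette sum around every
link is negative. Putting the two together:

* `fst_apply_eq_zero_of_mem_plaquettesTouching_single` — a plaquette containing the link `(x, i)`
  with `x_i = 0` has its base point on the layer `x_i = 0` and lies in a plane containing `i`;
* `IsCovariantLinkRP.integral_plaquetteObs_nonneg` — covariant link RP in the mirror `x_i = ½`
  gives `0 ≤ ∫ Re tr ρ(U_p) dμ` for every plaquette `p` in a plane containing `i` with base point
  on the layer `x_i = 0` (both orientations; the `1 × 1` cut-loop block of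
  `ClassBLimitLinkCutWordBlocks.lean` plus `Re tr ρ(g⁻¹) = Re tr ρ(g)`);
  `IsCovariantLinkRP.sum_integral_plaquetteObs_nonneg` — hence `0 ≤ Σ_{p ∋ (x,i)} ∫ Re tr ρ(U_p) dμ`;
* ★★★ **`IsCovariantLinkRP.false_of_haarShift_of_neg`** /
  **`IsHaarShiftState.not_isCovariantLinkRP_of_neg`** — NO probability measure on `LGConfig d G`
  with the one-link Haar-shift identity at `β < 0` is covariantly link-RP along ANY axis (`ρ`
  continuous without invariant vectors, `N ≥ 1`, `d ≥ 2`; no translation invariance, no other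
  mirror assumed). In particular a "covariant Class B / Class T" (the structures of `ClassB.lean` /
  `TiltedBoxLimitClass.lean` with `IsCovariantLinkRP` in place of the plain `linkRP` field along
  one axis) is EMPTY at `β < 0` in EVERY dimension `d ≥ 2` — whereas the plain Class T in `d ≥ 3`
  at `β < 0` stays open (its `linkRP` field is the plain form, which gives no plaquette sign);
* ★★★ **`isCovariantLinkRP_iff_nonneg_of_mem_infiniteVolumeLimitPoints`** — for every
  infinite-volume limit point `μ` of the torus Wilson states and every axis `i`:
  `IsCovariantLinkRP i μ ↔ 0 ≤ β` (`⇐`: `ClassBLimitCovariantLinkRP.lean`; `⇒`: the above);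
  ★★★ **`TiltedRP.isCovariantLinkRP_iff_nonneg_of_mem_tiltedBoxLimitPoints`** — the same for
  the tilted limit points along `k ∉ {i, j}`, and `not_isCovariantLinkRP_of_mem_tiltedBoxLimitPoints_of_neg`
  for every axis; `not_isCovariantLinkRP_of_mem_ymGibbsMeasures_of_neg` — no DLR state at `β < 0`
  is covariantly link-RP; `_suN` forms.

So the Kazakov–Zheng CUT-LOOP `R_link` blocks are exact constraints for torus / tilted limit
points EXACTLY on `β ≥ 0`; at `β < 0` the `1 × 1` cut-loop block (the plaquette) already has the
wrong sign. Contrast: the PLAIN link RP of `ClassB.lean` holds on the even torus at every real `β`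
for `SU(2)`, `SU(2n)`, `U(N)` (`CubicTorusLinkRPAnyBeta.lean`) and in `d = 2` for every `G`
(`CubicTorusLinkRPTwoDim.lean`) — the two notions differ (the converse of
`IsCovariantLinkRP.linkRP` fails; a limit-point witness is the business of a sequel).

Elementary; not in print in this form as far as the cell's searches go (OS link RP: Osterwalder–
Seiler 1978 §2, Seiler LNP 159 Thm. 2.2; cut loops: Kazakov–Zheng arXiv:2203.11360 §3.1).
-/

open MeasureTheory Complex Finset Function
open scoped ComplexOrder ComplexConjugate

namespace Summit.QuantumFields.GaugeBoot

open Literature.MathematicalPhysics.QuantumFieldTheory (haarProbability)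
open Literature.MathematicalPhysics.QuantumLattice
open Literature.RepresentationTheory.CompactGroups
open Literature.Probability.LatticeModels (Site IsGibbsMeasure)

noncomputable section

variable {d N : ℕ} {G : Type*} [Group G] [TopologicalSpace G] [IsTopologicalGroup G]
  [CompactSpace G] [MeasurableSpace G] [BorelSpace G] (ρ : G →* Matrix (Fin N) (Fin N) ℂ)

/-! ## Plaquettes around a link of the layer `x_i = 0` -/

section Geometry

/-- **A plaquette containing the link `(x, i)` with `x_i = 0` has its base point on the layer
`x_i = 0` and lies in a plane containing the direction `i`.** -/
theorem fst_apply_eq_zero_of_mem_plaquettesTouching_single {i : Fin d} {x : Site d} (hx : x i = 0)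
    {p : ZdPlaquette d} (hp : p ∈ plaquettesTouching ({(x, i)} : Finset (ZdEdge d))) :
    p.1 i = 0 ∧ (p.2.1.1 = i ∨ p.2.1.2 = i) := by
  obtain ⟨e, he⟩ := mem_plaquettesTouching_iff.1 hp
  rw [Finset.mem_inter, Finset.mem_singleton] at he
  obtain ⟨he1, rfl⟩ := he
  have hab : p.2.1.1 ≠ p.2.1.2 := ne_of_lt p.2.2
  simp only [plaquetteEdges, Finset.mem_insert, Finset.mem_singleton, Prod.ext_iff] at he1
  rcases he1 with ⟨h1, h2⟩ | ⟨h1, h2⟩ | ⟨h1, h2⟩ | ⟨h1, h2⟩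
  · exact ⟨by rw [← h1]; exact hx, Or.inl h2.symm⟩
  · refine ⟨?_, Or.inr h2.symm⟩
    have h := congrFun h1 i
    rw [Pi.add_apply, Pi.single_eq_of_ne (fun h' : i = p.2.1.1 => hab (h'.symm.trans h2)),
      add_zero] at h
    rw [← h]; exact hx
  · refine ⟨?_, Or.inl h2.symm⟩
    have h := congrFun h1 i
    rw [Pi.add_apply, Pi.single_eq_of_ne (fun h' : i = p.2.1.2 => hab (h2.symm.trans h')),
      add_zero] at h
    rw [← h]; exact hx
  · exact ⟨by rw [← h1]; exact hx, Or.inr h2.symm⟩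

end Geometry

/-! ## Covariant link RP gives non-negative plaquettes in the planes containing the axis -/

section Plaquettes

variable [NeZero N]

/-- **Covariant link RP makes the plaquettes through the mirror non-negative.** For a probability
measure `μ` with `IsCovariantLinkRP i μ` and continuous `ρ` (`N ≥ 1`): `0 ≤ ∫ Re tr ρ(U_p) dμ` for
every plaquette `p = (y; a, b)`, `a ≠ b`, in a plane containing `i` (`a = i` or `b = i`) with base
point on the layer `y_i = 0` — both orientations (the `1 × 1` cut-loop block
`integral_wordLoopZd_plaquette_nonneg_of_isCovariantLinkRP`, and `Re tr ρ(g⁻¹) = Re tr ρ(g)`). -/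
theorem IsCovariantLinkRP.integral_plaquetteObs_nonneg (hρ : Continuous ρ)
    {μ : Measure (LGConfig d G)} [IsProbabilityMeasure μ] {i : Fin d} (hμ : IsCovariantLinkRP i μ)
    {y : Site d} (hy : y i = 0) {a b : Fin d} (hab : a ≠ b) (hi : a = i ∨ b = i) :
    0 ≤ ∫ U, plaquetteObs ρ y a b U ∂μ := by
  have hN : (0 : ℝ) < N := by exact_mod_cast Nat.pos_of_ne_zero (NeZero.ne N)
  -- the oriented plaquette `P_{ik}`, `k ≠ i`
  have key : ∀ {k : Fin d}, k ≠ i → 0 ≤ ∫ U, plaquetteObs ρ y i k U ∂μ := fun {k} hk => by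
    have h := integral_wordLoopZd_plaquette_nonneg_of_isCovariantLinkRP ρ hρ hμ hy hk
    have h' : ∫ U, wordLoopZd ρ y (Word.plaquette i k) U ∂μ =
        (N : ℝ)⁻¹ * ∫ U, plaquetteObs ρ y i k U ∂μ := by
      rw [← integral_const_mul]
      refine integral_congr_ae (ae_of_all _ fun U => ?_)
      simp only [wordLoopZd_apply, wordHolonomyZd_plaquette, plaquetteObs]
    rw [h'] at h
    exact (mul_nonneg_iff_of_pos_left (inv_pos.2 hN)).1 h
  rcases hi with rfl | rfl
  · exact key hab.symm
  · -- `b = i`: reverse the orientation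
    have hswap : (fun U => plaquetteObs ρ y a b U) = fun U => plaquetteObs ρ y b a U := by
      funext U
      simp only [plaquetteObs]
      rw [plaquetteHolonomyZd_swap U y b a, CompactGroup.re_trace_map_inv ρ hρ]
    rw [show (∫ U, plaquetteObs ρ y a b U ∂μ) = ∫ U, plaquetteObs ρ y b a U ∂μ from by rw [hswap]]
    exact key hab

/-- **Hence the plaquette sum around a link of the layer is non-negative**: for a probability
measure with `IsCovariantLinkRP i μ`, continuous `ρ`, and a site `x` with `x_i = 0`,
`0 ≤ Σ_{p ∋ (x, i)} ∫ Re tr ρ(U_p) dμ`. -/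
theorem IsCovariantLinkRP.sum_integral_plaquetteObs_nonneg (hρ : Continuous ρ)
    {μ : Measure (LGConfig d G)} [IsProbabilityMeasure μ] {i : Fin d} (hμ : IsCovariantLinkRP i μ)
    {x : Site d} (hx : x i = 0) :
    0 ≤ ∑ p ∈ plaquettesTouching ({(x, i)} : Finset (ZdEdge d)),
      ∫ U, plaquetteObs ρ p.1 p.2.1.1 p.2.1.2 U ∂μ :=
  Finset.sum_nonneg fun p hp => by
    obtain ⟨h0, hi⟩ := fst_apply_eq_zero_of_mem_plaquettesTouching_single hx hp
    exact hμ.integral_plaquetteObs_nonneg ρ hρ h0 (ne_of_lt p.2.2) hi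

end Plaquettes

/-! ## The inconsistency at negative coupling -/

section Negative

variable [NeZero N] [SecondCountableTopology G]

/-- ★★★ **Covariant link RP is inconsistent with the one-link Haar shift at `β < 0`.** `G`
compact metrisable; `ρ` continuous, `N ≥ 1`, without invariant vectors
(`∫ Re tr ρ(g m) dg = 0` for all `m`); `d ≥ 2`; `μ` a probability measure on `LGConfig d G` with
the one-link Haar-shift (DLR) identity at `β < 0`. Then `μ` is NOT covariantly link-RP along any
axis: the DLR sign rule makes `Σ_{p ∋ (0, i)} ∫ Re tr ρ(U_p) dμ < 0`, covariant link RP in `x_i = ½`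
makes it `≥ 0`. No translation invariance, no other mirror is assumed. -/
theorem IsCovariantLinkRP.false_of_haarShift_of_neg (hρ : Continuous ρ)
    (hρ0 : ∀ m : G, ∫ g, ((ρ (g * m)).trace).re ∂(haarProbability G) = 0) (hd : 2 ≤ d) {β : ℝ}
    (hβ : β < 0) {μ : Measure (LGConfig d G)} [IsProbabilityMeasure μ]
    (hH : IsHaarShiftState ρ β μ) {i : Fin d} (hμ : IsCovariantLinkRP i μ) : False := by
  have hneg := hH.sum_integral_plaquetteObs_neg_of_neg ρ hρ hρ0 hd hβ ((0 : Site d), i)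
  have hnn := hμ.sum_integral_plaquetteObs_nonneg ρ hρ (x := (0 : Site d)) rfl
  linarith

/-- ★★★ **In a one-link Haar-shift state at `β < 0` no axis is covariantly link-RP** (`ρ` without
invariant vectors, `N ≥ 1`, `d ≥ 2`). A "covariant Class-B / Class-T state" at `β < 0` does not
exist in any dimension. -/
theorem IsHaarShiftState.not_isCovariantLinkRP_of_neg (hρ : Continuous ρ)
    (hρ0 : ∀ m : G, ∫ g, ((ρ (g * m)).trace).re ∂(haarProbability G) = 0) (hd : 2 ≤ d) {β : ℝ}
    (hβ : β < 0) {μ : Measure (LGConfig d G)} [IsProbabilityMeasure μ]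
    (hH : IsHaarShiftState ρ β μ) (i : Fin d) : ¬ IsCovariantLinkRP i μ :=
  fun hμ => hμ.false_of_haarShift_of_neg ρ hρ hρ0 hd hβ hH

/-- **Central-scalar form**: if `ρ z = ω • 1` with `ω ≠ 1` (`SU(N)`, `U(N)` fundamental), a
one-link Haar-shift state at `β < 0` is not covariantly link-RP along any axis. -/
theorem IsHaarShiftState.not_isCovariantLinkRP_of_neg_of_smul_one (hρ : Continuous ρ) {z : G}
    {ω : ℂ} (hz : ρ z = ω • (1 : Matrix (Fin N) (Fin N) ℂ)) (hω : ω ≠ 1) (hd : 2 ≤ d) {β : ℝ}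
    (hβ : β < 0) {μ : Measure (LGConfig d G)} [IsProbabilityMeasure μ]
    (hH : IsHaarShiftState ρ β μ) (i : Fin d) : ¬ IsCovariantLinkRP i μ :=
  hH.not_isCovariantLinkRP_of_neg ρ hρ (integral_re_trace_mul_eq_zero_of_smul_one ρ hρ hz hω) hd hβ i

/-- **No DLR state at `β < 0` is covariantly link-RP** (every `μ ∈ 𝒢(β)` of `LatticeGaugeDLR`,
`ρ` without invariant vectors, `d ≥ 2`). -/
theorem not_isCovariantLinkRP_of_mem_ymGibbsMeasures_of_neg [T2Space G] (hρ : Continuous ρ)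
    (hρ0 : ∀ m : G, ∫ g, ((ρ (g * m)).trace).re ∂(haarProbability G) = 0) (hd : 2 ≤ d) {β : ℝ}
    (hβ : β < 0) {μ : Measure (LGConfig d G)} (hμ : μ ∈ ymGibbsMeasures ρ β) (i : Fin d) :
    ¬ IsCovariantLinkRP i μ := by
  have hG : IsGibbsMeasure (ymSpecification ρ β) μ := hμ
  haveI := hG.isProbabilityMeasure
  exact (isHaarShiftState_of_mem_ymGibbsMeasures ρ hρ hμ).not_isCovariantLinkRP_of_neg ρ hρ hρ0 hd hβ i

end Negative

/-! ## Torus limit points: covariant link RP holds exactly on `β ≥ 0` -/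

section TorusLimitPoints

variable [NeZero N] [NeZero d] [SecondCountableTopology G] [T2Space G]

/-- **At `β < 0` no torus limit point is covariantly link-RP**, along any axis (`ρ` without
invariant vectors, `d ≥ 2`). -/
theorem not_isCovariantLinkRP_of_mem_infiniteVolumeLimitPoints_of_neg (hρ : Continuous ρ)
    (hρ0 : ∀ m : G, ∫ g, ((ρ (g * m)).trace).re ∂(haarProbability G) = 0) (hd : 2 ≤ d) {β : ℝ}
    (hβ : β < 0) {μ : Measure (LGConfig d G)} (hμ : μ ∈ infiniteVolumeLimitPoints (d := d) ρ β)
    (i : Fin d) : ¬ IsCovariantLinkRP i μ := by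
  obtain ⟨hprob, -, -, -, hhaar⟩ := classBInvariances_of_mem_infiniteVolumeLimitPoints ρ hρ hμ
  exact hhaar.not_isCovariantLinkRP_of_neg ρ hρ hρ0 hd hβ i

/-- ★★★ **Covariant link RP of torus limit points holds EXACTLY on `β ≥ 0`.** For `ρ` continuous
without invariant vectors (`N ≥ 1`), `d ≥ 2`, every infinite-volume limit point `μ` of the torus
Wilson states and every axis `i`: `IsCovariantLinkRP i μ ↔ 0 ≤ β`
(`⇐`: `covariantLinkRP_of_mem_infiniteVolumeLimitPoints`; `⇒`: the DLR sign rule). So the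
Kazakov–Zheng cut-loop `R_link` blocks are exact constraints for these states exactly on `β ≥ 0`. -/
theorem isCovariantLinkRP_iff_nonneg_of_mem_infiniteVolumeLimitPoints (hρ : Continuous ρ)
    (hρ0 : ∀ m : G, ∫ g, ((ρ (g * m)).trace).re ∂(haarProbability G) = 0) (hd : 2 ≤ d) {β : ℝ}
    {μ : Measure (LGConfig d G)} (hμ : μ ∈ infiniteVolumeLimitPoints (d := d) ρ β) (i : Fin d) :
    IsCovariantLinkRP i μ ↔ 0 ≤ β := by
  refine ⟨fun h => ?_, fun hβ => covariantLinkRP_of_mem_infiniteVolumeLimitPoints ρ hρ hβ hμ i⟩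
  by_contra hβ
  push Not at hβ
  exact not_isCovariantLinkRP_of_mem_infiniteVolumeLimitPoints_of_neg ρ hρ hρ0 hd hβ hμ i h

/-- **Central-scalar form** of the dichotomy (`ρ z = ω • 1`, `ω ≠ 1`). -/
theorem isCovariantLinkRP_iff_nonneg_of_mem_infiniteVolumeLimitPoints_of_smul_one
    (hρ : Continuous ρ) {z : G} {ω : ℂ} (hz : ρ z = ω • (1 : Matrix (Fin N) (Fin N) ℂ)) (hω : ω ≠ 1)
    (hd : 2 ≤ d) {β : ℝ} {μ : Measure (LGConfig d G)}
    (hμ : μ ∈ infiniteVolumeLimitPoints (d := d) ρ β) (i : Fin d) :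
    IsCovariantLinkRP i μ ↔ 0 ≤ β :=
  isCovariantLinkRP_iff_nonneg_of_mem_infiniteVolumeLimitPoints ρ hρ
    (integral_re_trace_mul_eq_zero_of_smul_one ρ hρ hz hω) hd hμ i

end TorusLimitPoints

/-! ## Tilted (Class-T) limit points -/

namespace TiltedRP

variable {i j k : Fin d} [NeZero N] [SecondCountableTopology G]

/-- **At `β < 0` no tilted limit point is covariantly link-RP**, along ANY axis `k` (in-plane or
transverse; `ρ` without invariant vectors, `d ≥ 2`): tilted limit points are one-link Haar-shift
states at every real `β` (`isHaarShiftState_of_mem_tiltedBoxLimitPoints`). -/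
theorem not_isCovariantLinkRP_of_mem_tiltedBoxLimitPoints_of_neg (hρ : Continuous ρ)
    (hρ0 : ∀ m : G, ∫ g, ((ρ (g * m)).trace).re ∂(haarProbability G) = 0) (hd : 2 ≤ d) {β : ℝ}
    (hβ : β < 0) {μ : Measure (LGConfig d G)} (hμ : μ ∈ tiltedBoxLimitPoints d i j ρ β)
    (k : Fin d) : ¬ IsCovariantLinkRP k μ := by
  haveI := isProbabilityMeasure_of_mem_tiltedBoxLimitPoints hμ
  exact (isHaarShiftState_of_mem_tiltedBoxLimitPoints ρ hρ hμ).not_isCovariantLinkRP_of_neg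
    ρ hρ hρ0 hd hβ k

/-- ★★★ **Covariant link RP of tilted limit points along `k ∉ {i, j}` holds EXACTLY on `β ≥ 0`**
(`ρ` continuous without invariant vectors, `N ≥ 1`, `d ≥ 2`):
`IsCovariantLinkRP k μ ↔ 0 ≤ β` for every `μ ∈ tiltedBoxLimitPoints d i j ρ β`
(`⇐`: `covariantLinkRP_of_mem_tiltedBoxLimitPoints`; `⇒`: the DLR sign rule). -/
theorem isCovariantLinkRP_iff_nonneg_of_mem_tiltedBoxLimitPoints (hki : k ≠ i) (hkj : k ≠ j)
    (hρ : Continuous ρ) (hρ0 : ∀ m : G, ∫ g, ((ρ (g * m)).trace).re ∂(haarProbability G) = 0)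
    (hd : 2 ≤ d) {β : ℝ} {μ : Measure (LGConfig d G)} (hμ : μ ∈ tiltedBoxLimitPoints d i j ρ β) :
    IsCovariantLinkRP k μ ↔ 0 ≤ β := by
  refine ⟨fun h => ?_, fun hβ => covariantLinkRP_of_mem_tiltedBoxLimitPoints ρ hki hkj hρ hβ hμ⟩
  by_contra hβ
  push Not at hβ
  exact not_isCovariantLinkRP_of_mem_tiltedBoxLimitPoints_of_neg ρ hρ hρ0 hd hβ hμ k h

end TiltedRP

/-! ## The concrete groups -/

section Groups

/-- ★★★ **`SU(N)` (`N ≥ 2`), `d ≥ 2`, `β < 0`: no one-link Haar-shift state is covariantly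
link-RP along any axis** — in particular no torus / tilted limit point and no DLR state. -/
theorem not_isCovariantLinkRP_of_haarShift_suN {d N : ℕ} (hd : 2 ≤ d) (hN : 2 ≤ N) {β : ℝ}
    (hβ : β < 0) {μ : Measure (LGConfig d (Matrix.specialUnitaryGroup (Fin N) ℂ))}
    [IsProbabilityMeasure μ] (hμ : IsHaarShiftState (fundamentalRep (Fin N)) β μ) (i : Fin d) :
    ¬ IsCovariantLinkRP i μ := by
  haveI : NeZero N := ⟨by omega⟩
  haveI : SecondCountableTopology (Matrix (Fin N) (Fin N) ℂ) :=
    inferInstanceAs (SecondCountableTopology (Fin N → Fin N → ℂ))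
  haveI : SecondCountableTopology (Matrix.specialUnitaryGroup (Fin N) ℂ) :=
    Topology.IsEmbedding.subtypeVal.secondCountableTopology
  obtain ⟨z, ζ, hζ1, hz, -⟩ :=
    Literature.MathematicalPhysics.QuantumFieldTheory.IsSpecialUnitaryModel.exists_central
      (fundamentalRep (Fin N))
      (Literature.MathematicalPhysics.QuantumFieldTheory.TorusAreaLaw.isSpecialUnitaryModel_fundamentalRep
        N) hN
  exact hμ.not_isCovariantLinkRP_of_neg_of_smul_one (fundamentalRep (Fin N))
    (continuous_fundamentalRep (Fin N)) hz hζ1 hd hβ i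

/-- ★★★ **`SU(N)` torus limit points: covariant link RP `↔ 0 ≤ β`** (`N ≥ 2`, `d ≥ 2`, every
axis). -/
theorem isCovariantLinkRP_iff_nonneg_of_mem_infiniteVolumeLimitPoints_suN {d N : ℕ} [NeZero d]
    (hd : 2 ≤ d) (hN : 2 ≤ N) {β : ℝ}
    {μ : Measure (LGConfig d (Matrix.specialUnitaryGroup (Fin N) ℂ))}
    (hμ : μ ∈ infiniteVolumeLimitPoints (d := d) (fundamentalRep (Fin N)) β) (i : Fin d) :
    IsCovariantLinkRP i μ ↔ 0 ≤ β := by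
  haveI : NeZero N := ⟨by omega⟩
  haveI : SecondCountableTopology (Matrix (Fin N) (Fin N) ℂ) :=
    inferInstanceAs (SecondCountableTopology (Fin N → Fin N → ℂ))
  haveI : SecondCountableTopology (Matrix.specialUnitaryGroup (Fin N) ℂ) :=
    Topology.IsEmbedding.subtypeVal.secondCountableTopology
  obtain ⟨z, ζ, hζ1, hz, -⟩ :=
    Literature.MathematicalPhysics.QuantumFieldTheory.IsSpecialUnitaryModel.exists_central
      (fundamentalRep (Fin N))
      (Literature.MathematicalPhysics.QuantumFieldTheory.TorusAreaLaw.isSpecialUnitaryModel_fundamentalRep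
        N) hN
  exact isCovariantLinkRP_iff_nonneg_of_mem_infiniteVolumeLimitPoints_of_smul_one (fundamentalRep (Fin N))
    (continuous_fundamentalRep (Fin N)) hz hζ1 hd hμ i

end Groups

end

end Summit.QuantumFields.GaugeBoot
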